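import Literature.NumberTheory.GaloisRepresentations.CyclicHerbrandQuotient
import Literature.NumberTheory.GaloisRepresentations.LocalClassFieldAxiom
import HarnessLib

/-!
# Congruence subgroups attached to a normal basis are cohomologically trivial (semi-local form)

Topic `NumberTheory/GaloisRepresentations` (class field theory: the local input of the global
cyclic norm index computation, Childress, *Class Field Theory*, Ch. 4 Lemma 5.3 / Prop. 5.7 (i):
"for a finite place `w`, `Q_{G_w}(𝒰_w) = 1`"); namespace
`Literature.NumberTheory.GaloisRepresentations.NormalBasisCongr`.  Definitions with their API;
everything is **proved**.

## What is proved, and why in this form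

Childress proves `Q(𝒰_w) = 1` with the `p`-adic exponential (`exp : p^N 𝒪 ≅ B` open of finite
index, `Q(B) = Q(𝒪) = 1`, PDF pp. 92–93).  We follow instead Neukirch's normal-basis argument
(*Algebraic Number Theory*, Ch. V §1, proof of Thm. (1.1): for a normal basis `{α^σ}` and
`M = ∑ 𝒪_K α^σ`, the groups `Vⁿ = 1 + π_Kⁿ M` are `G`-stable open subgroups of finite index of the
units with `Vⁿ/Vⁿ⁺¹ ≅ M/π_K M = Ind_G(𝒪_K/𝔭_K)`, hence `Hⁱ(G, Vⁿ) = 1` for `i = 0, -1`), exactly as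
formalised for a cyclic extension of *fields* `L/K` in `LocalClassFieldAxiom.lean`
(`CyclicNormIndex.latt/congr/congrUnits`, `exists_galNorm_eq`, `exists_twist_eq`).  The global
computation needs the same statement for the **semi-local algebra** `E ⊗_F F_v = ∏_{w ∣ v} E_w`
of a cyclic extension of number fields at a place `v` of `F`, which is not a field; so this file
redoes the construction for

* `K` a normed, ultrametric (complete) field, `π ∈ K` with `‖π‖ < 1` (for `π = 0` everything is
  trivially true and void);
* `L` any commutative `K`-algebra (`[CommRing L] [Algebra K L]`);
* `G` a finite group acting on `L` by `K`-linear ring automorphisms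
  (`[MulSemiringAction G L] [SMulCommClass G K L]`), `σ ∈ G` a generator;
* `b : Module.Basis G K L` a **normal basis** (`g • b h = b (g h)`) whose structure constants lie
  in `π 𝒪_K` (`hmul`; obtained in the application by scaling),

and phrases the conclusions in the language of `CyclicHerbrandQuotient.lean` (ambient module
`Lˣ` with the action `Units.mulDistribMulActionRight`, a *scoped* instance on `Lˣ` here).  The
lattices `latt b π r = π^r ⊕_g 𝒪_K b_g`, congruence sets `CyclicNormIndex.congr b π r = 1 + latt r` and subgroups
`congrUnits … r = V_r ≤ Lˣ` are those of `LocalClassFieldAxiom.lean` (`CyclicNormIndex.latt/congr/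
congrUnits`, stated there for `[CommRing L]`); this file adds:

* `isStable_congrUnits` — `V_r` is `G`-stable;
* `h0_congrUnits_eq_one`, `h1_congrUnits_eq_one` — **`H⁰(G, V_r) = H⁻¹(G, V_r) = 1`**
  (`Herbrand.h0 σ V_r ⊥ = 1`, `Herbrand.h1 σ V_r ⊥ = 1`): the graded pieces
  (`exists_norm_sub_mem_latt`: a class invariant modulo `M_{r+1}` has congruent coordinates and is
  the class of `∑_g g • (m₁ b₁)`; `exists_twist_sub_mem_latt`: a class of coordinate sum `0` is
  `σu - u`, the telescoping identity of `LocalClassFieldAxiom.lean`), the multiplicative one-step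
  lemmas and the successive approximation `exists_apply_eq_of_step_units` (in `Lˣ`, for a monoid
  endomorphism preserving the `V_s`), as in the source file;
* `exists_norm_eq_of_fixed`, `exists_twist_eq_of_norm_eq_one` — the same two statements
  elementwise; `exists_eq_one_add_smul_sum_of_fixed` / `exists_norm_eq_one_add_smul_sum` — the
  `G`-fixed elements of `V_r` are the `1 + c · t`, `t = ∑_g b_g`, `‖c‖ ≤ ‖π‖^r`, and every such
  element is a norm from `V_r` (used downstream to see that local norm groups contain
  `1 + 𝔭_v^k`).

## References

* J. Neukirch, *Algebraic Number Theory*, Grundlehren 322, Springer 1999, Ch. V §1 Thm. (1.1)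
  (proof) and Ch. IV §7 Prop. (7.4). [NeukirchANT1999]
* N. Childress, *Class Field Theory*, Universitext, Springer 2009, Ch. 4 §5 Lemma 5.3,
  Prop. 5.7 (i) (PDF pp. 92–94, 98). [Childress2009]

## Mathlib / tree

Reuses `CyclicNormIndex.latt/congr/congrUnits` with their closure, inversion and completeness
lemmas and `CyclicNormIndex.sum_range_card_pow_eq_sum` (`LocalClassFieldAxiom.lean`, whose lattice
and congruence sections are stated for `[CommRing L]`; the telescoping identity
`CyclicNormIndex.telescope_identity` is restated for an arbitrary module as `telescope_sub_shift`),
and the index calculus of `CyclicHerbrandQuotient.lean`; Mathlib `Module.Basis`, `IsUltrametricDist`,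
`Units.mulDistribMulActionRight`.  The group is an abstract finite `G` with a `G`-indexed normal
basis (instead of `L ≃ₐ[K] L` as in the field case), which is what the semi-local application needs.
-/

noncomputable section

open Filter Topology

namespace Literature.NumberTheory.GaloisRepresentations

namespace NormalBasisCongr

open CyclicNormIndex

/-! ### A finite group acting through a normal basis -/

section Action

variable {K : Type*} [NormedField K] [IsUltrametricDist K]
variable {L : Type*} [CommRing L] [Algebra K L]
variable {G : Type*} [Group G] [Fintype G] [MulSemiringAction G L] [SMulCommClass G K L]
variable {b : Module.Basis G K L} {π : K}

/-- The action of `G` on the units `Lˣ` (Mathlib `Units.mulDistribMulActionRight`: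
`((g • u : Lˣ) : L) = g • (u : L)`).  Mathlib keeps this a non-instance (it forms a non-defeq
diamond with `ConjAct.instMulDistribMulAction`); it is registered here as a **scoped** instance of
the namespace `NormalBasisCongr` only, and concrete applications register it for their specific
algebra (as `ClassFieldCharacter.lean` does for the idele group). [folklore] -/
scoped instance instMulDistribMulActionUnits : MulDistribMulAction G Lˣ := Units.mulDistribMulActionRight

omit [Fintype G] [SMulCommClass G K L] in
/-- `((g • u : Lˣ) : L) = g • (u : L)` (definitional). [folklore] -/
@[simp] theorem val_smul_units (g : G) (u : Lˣ) : ((g • u : Lˣ) : L) = g • (u : L) := rfl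

omit [IsUltrametricDist K] in
/-- **The group permutes the coordinates**: `(g • x)_i = x_{g⁻¹ i}` in a normal basis
(`g • b_h = b_{gh}`). [cite: NeukirchANT1999, Ch. V §1 Thm. (1.1) (proof)] -/
theorem repr_smul (hb : ∀ g h : G, g • b h = b (g * h)) (g : G) (x : L) (i : G) :
    b.repr (g • x) i = b.repr x (g⁻¹ * i) := by
  classical
  have hx : g • x = ∑ j, b.repr x (g⁻¹ * j) • b j := by
    conv_lhs => rw [← b.sum_repr x]
    rw [Finset.smul_sum]
    simp_rw [smul_comm g, hb]
    exact Fintype.sum_equiv (Equiv.mulLeft g) _ _ (fun j => by simp)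
  rw [hx, b.repr_sum_self]

/-- `M_r` is `G`-stable. [cite: NeukirchANT1999, Ch. V §1 Thm. (1.1) (proof)] -/
theorem gal_smul_mem_latt (hb : ∀ g h : G, g • b h = b (g * h)) (g : G) {r : ℕ} {x : L}
    (hx : x ∈ latt b π r) : g • x ∈ latt b π r := fun i => by
  rw [repr_smul hb]; exact hx _

/-- `V_r` is `G`-stable. [cite: NeukirchANT1999, Ch. V §1 Thm. (1.1) (proof)] -/
theorem gal_smul_mem_congr (hb : ∀ g h : G, g • b h = b (g * h)) (g : G) {r : ℕ} {x : L}
    (hx : x ∈ CyclicNormIndex.congr b π r) : g • x ∈ CyclicNormIndex.congr b π r := by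
  rw [mem_congr_iff, ← smul_one g, ← smul_sub]
  exact gal_smul_mem_latt hb g hx

/-- `V_r ≤ Lˣ` is a `G`-stable subgroup. [cite: NeukirchANT1999, Ch. V §1 Thm. (1.1) (proof)] -/
theorem isStable_congrUnits [CompleteSpace K] (hb : ∀ g h : G, g • b h = b (g * h))
    (hmul : ∀ i j k, ‖b.repr (b i * b j) k‖ ≤ ‖π‖) (hπ : ‖π‖ < 1) (r : ℕ) :
    Herbrand.IsStable G (congrUnits b π hmul hπ r) :=
  fun g _ hu => gal_smul_mem_congr hb g hu

omit [SMulCommClass G K L] in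
/-- The norm of the Herbrand calculus on `Lˣ` is `∏_g g • u` in `L`. [folklore] -/
theorem val_norm (u : Lˣ) : ((Herbrand.norm G u : Lˣ) : L) = ∏ g : G, g • (u : L) := by
  rw [Herbrand.norm_apply, Units.coe_prod]
  rfl

omit [Fintype G] [SMulCommClass G K L] in
/-- The twist of the Herbrand calculus on `Lˣ` is `σ • u / u`. [folklore] -/
theorem val_twist (σ : G) (u : Lˣ) :
    ((Herbrand.twist σ u : Lˣ) : L) = σ • (u : L) * ((u⁻¹ : Lˣ) : L) := by
  rw [Herbrand.twist_apply, div_eq_mul_inv, Units.val_mul]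
  rfl

/-- `N_G` preserves each `V_s`. [folklore] -/
theorem norm_mem_congrUnits [CompleteSpace K] (hb : ∀ g h : G, g • b h = b (g * h))
    (hmul : ∀ i j k, ‖b.repr (b i * b j) k‖ ≤ ‖π‖) (hπ : ‖π‖ < 1) {s : ℕ} {u : Lˣ}
    (hu : u ∈ congrUnits b π hmul hπ s) : Herbrand.norm G u ∈ congrUnits b π hmul hπ s :=
  (isStable_congrUnits hb hmul hπ s).norm_mem hu

/-- `σ - 1` preserves each `V_s`. [folklore] -/
theorem twist_mem_congrUnits [CompleteSpace K] (hb : ∀ g h : G, g • b h = b (g * h))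
    (hmul : ∀ i j k, ‖b.repr (b i * b j) k‖ ≤ ‖π‖) (hπ : ‖π‖ < 1) (σ : G) {s : ℕ} {u : Lˣ}
    (hu : u ∈ congrUnits b π hmul hπ s) : Herbrand.twist σ u ∈ congrUnits b π hmul hπ s :=
  (isStable_congrUnits hb hmul hπ s).twist_mem σ hu

omit [IsUltrametricDist K] [SMulCommClass G K L] in
/-- The sum of the basis vectors `t = ∑_g b_g` is `G`-fixed. [folklore] -/
theorem smul_sum_basis (hb : ∀ g h : G, g • b h = b (g * h)) (g : G) :
    g • ∑ h : G, b h = ∑ h : G, b h := by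
  rw [Finset.smul_sum]
  simp_rw [hb]
  exact Fintype.sum_equiv (Equiv.mulLeft g) _ _ fun h => rfl

/-- **Fixed elements of the induced lattice have equal coordinates**: if `g • m - m ∈ M_s` for all
`g` then `‖m_g - m_1‖ ≤ ‖π‖^s` for all `g`. [cite: NeukirchANT1999, Ch. IV §7 Prop. (7.4)] -/
theorem norm_repr_sub_repr_one_le (hb : ∀ g h : G, g • b h = b (g * h)) {s : ℕ} {m : L}
    (hfix : ∀ g : G, g • m - m ∈ latt b π s) (g : G) : ‖b.repr m g - b.repr m 1‖ ≤ ‖π‖ ^ s := by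
  have := hfix g⁻¹ 1
  rwa [map_sub, Finsupp.sub_apply, repr_smul hb, inv_inv, mul_one] at this

end Action

/-! ### The graded pieces `V_r/V_{r+1} ≅ ⊕_G 𝓀` are cohomologically trivial -/

section Graded

variable {K : Type*} [NormedField K] [IsUltrametricDist K]
variable {L : Type*} [CommRing L] [Algebra K L]
variable {G : Type*} [Group G] [Fintype G] [MulSemiringAction G L] [SMulCommClass G K L]
variable {b : Module.Basis G K L} {π : K} {σ : G}

/-- **`H⁰` of the graded piece** (`M_r/M_{r+1} = Ind_G(𝒪/π)` has `H⁰ = 1`, Neukirch IV (7.4)): if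
`m ∈ M_r` is `G`-invariant modulo `M_{r+1}` then `m ≡ ∑_g g • m₀ (mod M_{r+1})` for some
`m₀ ∈ M_r` (namely `m₀ = m_1 · b_1`: all coordinates of `m` are congruent).
[cite: NeukirchANT1999, Ch. V §1 Thm. (1.1) (proof); Ch. IV §7 Prop. (7.4)] -/
theorem exists_norm_sub_mem_latt (hb : ∀ g h : G, g • b h = b (g * h)) {r : ℕ} {m : L}
    (hm : m ∈ latt b π r) (hfix : ∀ g : G, g • m - m ∈ latt b π (r + 1)) :
    ∃ m₀ ∈ latt b π r, (∑ g : G, g • m₀) - m ∈ latt b π (r + 1) := by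
  classical
  set c : K := b.repr m 1 with hc
  refine ⟨c • b 1, smul_basis_mem_latt (hm 1) 1, ?_⟩
  have hsum : ∑ g : G, g • (c • b 1) = ∑ g : G, c • b g := by
    refine Finset.sum_congr rfl fun g _ => ?_
    rw [smul_comm g, hb, mul_one]
  have hall : ∀ g : G, ‖c - b.repr m g‖ ≤ ‖π‖ ^ (r + 1) := fun g => by
    rw [norm_sub_rev]; exact norm_repr_sub_repr_one_le hb hfix g
  rw [hsum]
  have hm' : ∑ g, c • b g - m = ∑ g, (c - b.repr m g) • b g := by
    simp_rw [sub_smul, Finset.sum_sub_distrib, b.sum_repr]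
  rw [hm']
  exact (sum_smul_mem_latt_iff _).mpr hall

/-- The telescoping identity behind `H⁻¹` of the graded piece (any module): with
`c_j = ∑_{i≤j} μ_i`, `∑_{j<N} c_j e_j - ∑_{j<N} c_j e_{j+1} = ∑_{j<N} μ_j e_j - (∑_{i<N} μ_i) e_N`
(the statement of `CyclicNormIndex.telescope_identity`, freed of its normed-field context).
[folklore] -/
theorem telescope_sub_shift {R M : Type*} [CommRing R] [AddCommGroup M] [Module R M] (μ : ℕ → R)
    (e : ℕ → M) (N : ℕ) :
    (∑ j ∈ Finset.range N, (∑ i ∈ Finset.range (j + 1), μ i) • e j) -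
        ∑ j ∈ Finset.range N, (∑ i ∈ Finset.range (j + 1), μ i) • e (j + 1) =
      (∑ j ∈ Finset.range N, μ j • e j) - (∑ i ∈ Finset.range N, μ i) • e N := by
  induction N with
  | zero => simp
  | succ N ih =>
    rw [Finset.sum_range_succ (fun j => (∑ i ∈ Finset.range (j + 1), μ i) • e j),
      Finset.sum_range_succ (fun j => (∑ i ∈ Finset.range (j + 1), μ i) • e (j + 1)),
      Finset.sum_range_succ (fun j => μ j • e j), Finset.sum_range_succ μ]
    have h := ih
    rw [sub_eq_iff_eq_add] at h
    rw [h]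
    module

/-- **`H⁻¹` of the graded piece** (`Ind_G` has `H⁻¹ = 1`, Neukirch IV (7.4)): if `m ∈ M_r` has
coordinate sum `≡ 0 (mod π^{r+1})` then `m ≡ σ • u - u (mod M_{r+1})` for some `u ∈ M_r`, `σ` a
generator of `G` (`u = -∑_j (∑_{i≤j} m_{σ^i}) b_{σ^j}`, the telescoping identity of
`LocalClassFieldAxiom.lean`). [cite: NeukirchANT1999, Ch. V §1 Thm. (1.1) (proof); Ch. IV §7 Prop. (7.4)] -/
theorem exists_twist_sub_mem_latt (hb : ∀ g h : G, g • b h = b (g * h))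
    (hσ : ∀ τ : G, τ ∈ Subgroup.zpowers σ) {r : ℕ} {m : L} (hm : m ∈ latt b π r)
    (hs : ‖∑ g, b.repr m g‖ ≤ ‖π‖ ^ (r + 1)) :
    ∃ u ∈ latt b π r, (σ • u - u) - m ∈ latt b π (r + 1) := by
  classical
  set μ : ℕ → K := fun i => b.repr m (σ ^ i) with hμ
  set e : ℕ → L := fun j => b (σ ^ j) with he
  set cs : ℕ → K := fun j => ∑ i ∈ Finset.range (j + 1), μ i with hcs
  set u : L := -∑ j ∈ Finset.range (Nat.card G), cs j • e j with hu
  have hμle : ∀ i, ‖μ i‖ ≤ ‖π‖ ^ r := fun i => hm _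
  have hcsle : ∀ j, ‖cs j‖ ≤ ‖π‖ ^ r := fun j =>
    IsUltrametricDist.norm_sum_le_of_forall_le_of_nonneg (by positivity) fun i _ => hμle i
  refine ⟨u, ?_, ?_⟩
  · rw [hu]
    exact neg_mem (sum_mem fun j _ => smul_basis_mem_latt (hcsle j) _)
  · have hσe : ∀ j, σ • e j = e (j + 1) := fun j => by
      simp only [he]; rw [hb, ← pow_succ']
    have hσu : σ • u = -∑ j ∈ Finset.range (Nat.card G), cs j • e (j + 1) := by
      rw [hu, smul_neg, Finset.smul_sum]
      simp_rw [smul_comm σ, hσe]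
    have htel := telescope_sub_shift μ e (Nat.card G)
    have hen : e (Nat.card G) = b 1 := by simp only [he]; rw [pow_card_eq_one']
    have hsumμ : ∑ i ∈ Finset.range (Nat.card G), μ i = ∑ g, b.repr m g :=
      CyclicNormIndex.sum_range_card_pow_eq_sum hσ (fun g => b.repr m g)
    have hsumm : ∑ j ∈ Finset.range (Nat.card G), μ j • e j = m := by
      simp only [hμ, he]
      rw [CyclicNormIndex.sum_range_card_pow_eq_sum hσ (fun g => b.repr m g • b g), b.sum_repr]
    have key : σ • u - u - m = -((∑ g, b.repr m g) • b 1) := by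
      rw [hσu, hu]
      have : -(∑ j ∈ Finset.range (Nat.card G), cs j • e (j + 1)) -
          -(∑ j ∈ Finset.range (Nat.card G), cs j • e j) =
          (∑ j ∈ Finset.range (Nat.card G), cs j • e j) -
            ∑ j ∈ Finset.range (Nat.card G), cs j • e (j + 1) := by abel
      rw [this, htel, hen, hsumμ, hsumm]
      abel
    rw [key]
    exact neg_mem (smul_basis_mem_latt hs 1)

/-- `∏_g g • (1 + m) ≡ 1 + ∑_g g • m (mod M_{2r+1})` for `m ∈ M_r`. [folklore] -/
theorem prod_smul_one_add_sub_mem_latt (hb : ∀ g h : G, g • b h = b (g * h))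
    (hmul : ∀ i j k, ‖b.repr (b i * b j) k‖ ≤ ‖π‖) (hπ : ‖π‖ ≤ 1) {r : ℕ} {m : L}
    (hm : m ∈ latt b π r) :
    (∏ g : G, g • (1 + m)) - (1 + ∑ g : G, g • m) ∈ latt b π (r + r + 1) := by
  have : ∏ g : G, g • (1 + m) = ∏ g : G, (1 + g • m) := by
    simp only [smul_add, smul_one]
  rw [this]
  exact prod_one_add_sub_mem_latt hmul hπ _ fun g _ => gal_smul_mem_latt hb _ hm

variable [CompleteSpace K]

/-- **`H⁰` step**: a `G`-fixed `x ∈ V_r` is a norm from `V_r` up to `V_{r+1}`.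
[cite: NeukirchANT1999, Ch. V §1 Thm. (1.1) (proof)] -/
theorem exists_div_norm_mem_congrUnits (hb : ∀ g h : G, g • b h = b (g * h))
    (hmul : ∀ i j k, ‖b.repr (b i * b j) k‖ ≤ ‖π‖) (hπ : ‖π‖ < 1) {r : ℕ} {x : Lˣ}
    (hx : x ∈ congrUnits b π hmul hπ r) (hfix : ∀ g : G, g • x = x) :
    ∃ w ∈ congrUnits b π hmul hπ r, x / Herbrand.norm G w ∈ congrUnits b π hmul hπ (r + 1) := by
  set m := (x : L) - 1 with hm
  have hmM : m ∈ latt b π r := hx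
  have hx1 : (x : L) = 1 + m := by rw [hm]; ring
  have hfix' : ∀ g : G, g • m - m ∈ latt b π (r + 1) := fun g => by
    have : g • m - m = 0 := by
      rw [hm, smul_sub, smul_one, ← val_smul_units, hfix g]; ring
    rw [this]; exact zero_mem _
  obtain ⟨m₀, hm₀, hdiff⟩ := exists_norm_sub_mem_latt hb hmM hfix'
  have hw : (1 + m₀) ∈ CyclicNormIndex.congr b π r := one_add_mem_congr_iff.mpr hm₀
  set w : Lˣ := (isUnit_of_mem_congr hmul hπ hw).unit with hwdef
  have hwval : (w : L) = 1 + m₀ := IsUnit.unit_spec _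
  have hwV : w ∈ congrUnits b π hmul hπ r := unit_mem_congrUnits hmul hπ hw
  refine ⟨w, hwV, ?_⟩
  have hNw : Herbrand.norm G w ∈ congrUnits b π hmul hπ r := norm_mem_congrUnits hb hmul hπ hwV
  refine div_mem_congrUnits_of_sub_mem hmul hπ hNw ?_
  have h1 := prod_smul_one_add_sub_mem_latt (G := G) hb hmul hπ.le hm₀
  have : (x : L) - (Herbrand.norm G w : Lˣ) =
      -(((∏ g : G, g • (1 + m₀)) - (1 + ∑ g : G, g • m₀)) + ((∑ g : G, g • m₀) - m)) := by
    rw [val_norm, hwval, hx1]; ring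
  rw [this]
  exact neg_mem (add_mem (latt_antitone hπ.le (by omega) h1) hdiff)

omit [IsUltrametricDist K] [CompleteSpace K] in
/-- The coordinate at `1` of `∑_g g • m` is the coordinate sum of `m`. [folklore] -/
theorem repr_sum_smul_one (hb : ∀ g h : G, g • b h = b (g * h)) (m : L) :
    b.repr (∑ g : G, g • m) 1 = ∑ g, b.repr m g := by
  rw [map_sum, Finsupp.coe_finsetSum, Finset.sum_apply]
  simp_rw [repr_smul hb, mul_one]
  exact Fintype.sum_equiv (Equiv.inv G) _ _ fun g => rfl

/-- **`H⁻¹` step**: a norm-one `x ∈ V_r` is `σ • w / w`, `w ∈ V_r`, up to `V_{r+1}`.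
[cite: NeukirchANT1999, Ch. V §1 Thm. (1.1) (proof)] -/
theorem exists_div_twist_mem_congrUnits (hb : ∀ g h : G, g • b h = b (g * h))
    (hσ : ∀ τ : G, τ ∈ Subgroup.zpowers σ)
    (hmul : ∀ i j k, ‖b.repr (b i * b j) k‖ ≤ ‖π‖) (hπ : ‖π‖ < 1) {r : ℕ} {x : Lˣ}
    (hx : x ∈ congrUnits b π hmul hπ r) (hN : Herbrand.norm G x = 1) :
    ∃ w ∈ congrUnits b π hmul hπ r, x / Herbrand.twist σ w ∈ congrUnits b π hmul hπ (r + 1) := by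
  set m := (x : L) - 1 with hm
  have hmM : m ∈ latt b π r := hx
  have hx1 : (x : L) = 1 + m := by rw [hm]; ring
  -- `∑ g • m ∈ M_{r+1}`, hence the coordinate sum of `m` is small
  have hsum : ∑ g : G, g • m ∈ latt b π (r + 1) := by
    have h1 := prod_smul_one_add_sub_mem_latt (G := G) hb hmul hπ.le hmM
    have hN' : ∏ g : G, g • (1 + m) = 1 := by
      rw [← hx1, ← val_norm, hN, Units.val_one]
    rw [hN', sub_add_eq_sub_sub, sub_self, zero_sub] at h1
    exact latt_antitone hπ.le (by omega) ((neg_mem_iff).mp h1)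
  have hs : ‖∑ g, b.repr m g‖ ≤ ‖π‖ ^ (r + 1) := by
    rw [← repr_sum_smul_one hb m]; exact hsum 1
  obtain ⟨u, hu, hdiff⟩ := exists_twist_sub_mem_latt hb hσ hmM hs
  have hw : (1 + u) ∈ CyclicNormIndex.congr b π r := one_add_mem_congr_iff.mpr hu
  set w : Lˣ := (isUnit_of_mem_congr hmul hπ hw).unit with hwdef
  have hwval : (w : L) = 1 + u := IsUnit.unit_spec _
  have hwV : w ∈ congrUnits b π hmul hπ r := unit_mem_congrUnits hmul hπ hw
  refine ⟨w, hwV, ?_⟩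
  have hσw : σ • w ∈ congrUnits b π hmul hπ r := isStable_congrUnits hb hmul hπ r σ hwV
  -- `x / (σw / w) = (x w) / σ w`
  have hrew : x / Herbrand.twist σ w = x * w / (σ • w) := by
    rw [Herbrand.twist_apply, div_div_eq_mul_div]
  rw [hrew]
  refine div_mem_congrUnits_of_sub_mem hmul hπ hσw ?_
  have : ((x * w : Lˣ) : L) - (σ • w : Lˣ) = -((σ • u - u) - m) + m * u := by
    rw [Units.val_mul, val_smul_units, hwval, hx1, smul_add, smul_one]; ring
  rw [this]
  exact add_mem (neg_mem hdiff) (latt_antitone hπ.le (by omega) (mul_mem_latt hmul hmM hu))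

omit [Group G] [MulSemiringAction G L] [SMulCommClass G K L] in
/-- **Successive approximation** in `Lˣ` (Neukirch: "`a = (N_G b_0) a_1`, `a_1 = (N_G b_1) a_2`,
…, this yields `a = N_G b` with the convergent product `b = ∏ b_i`"): for a monoid endomorphism
`Φ` of `Lˣ` preserving the `V_s`, a property `P`, and a one-step solvability hypothesis, every
`x ∈ V_r` with `P x` is `Φ y` with `y ∈ V_r`. [cite: NeukirchANT1999, Ch. V §1 Thm. (1.1) (proof)] -/
theorem exists_apply_eq_of_step_units (hmul : ∀ i j k, ‖b.repr (b i * b j) k‖ ≤ ‖π‖) (hπ : ‖π‖ < 1)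
    (Φ : Lˣ →* Lˣ) (hΦV : ∀ s, ∀ w ∈ congrUnits b π hmul hπ s, Φ w ∈ congrUnits b π hmul hπ s)
    (P : Lˣ → Prop) {r : ℕ}
    (step : ∀ s, r ≤ s → ∀ x ∈ congrUnits b π hmul hπ s, P x →
      ∃ w ∈ congrUnits b π hmul hπ s, x / Φ w ∈ congrUnits b π hmul hπ (s + 1) ∧ P (x / Φ w))
    {x : Lˣ} (hx : x ∈ congrUnits b π hmul hπ r) (hPx : P x) :
    ∃ y ∈ congrUnits b π hmul hπ r, Φ y = x := by
  classical
  -- a choice function for the step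
  have hch : ∀ (s : ℕ) (z : Lˣ), ∃ w : Lˣ, (r ≤ s ∧ z ∈ congrUnits b π hmul hπ s ∧ P z) →
      (w ∈ congrUnits b π hmul hπ s ∧ z / Φ w ∈ congrUnits b π hmul hπ (s + 1) ∧ P (z / Φ w)) := by
    intro s z
    by_cases h : r ≤ s ∧ z ∈ congrUnits b π hmul hπ s ∧ P z
    · obtain ⟨w, hw, h1, h2⟩ := step s h.1 z h.2.1 h.2.2
      exact ⟨w, fun _ => ⟨hw, h1, h2⟩⟩
    · exact ⟨1, fun h' => absurd h' h⟩
  choose W hW using hch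
  -- the sequences
  let xs : ℕ → Lˣ := fun k => Nat.rec x (fun k z => z / Φ (W (r + k) z)) k
  have hxs0 : xs 0 = x := rfl
  have hxss : ∀ k, xs (k + 1) = xs k / Φ (W (r + k) (xs k)) := fun k => rfl
  have hinv : ∀ k, xs k ∈ congrUnits b π hmul hπ (r + k) ∧ P (xs k) := by
    intro k
    induction k with
    | zero => exact ⟨hx, hPx⟩
    | succ k ih =>
      have := hW (r + k) (xs k) ⟨by omega, ih.1, ih.2⟩
      rw [hxss, show r + (k + 1) = r + k + 1 by ring]
      exact ⟨this.2.1, this.2.2⟩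
  let ws : ℕ → Lˣ := fun k => W (r + k) (xs k)
  have hwsV : ∀ k, ws k ∈ congrUnits b π hmul hπ (r + k) := fun k =>
    (hW (r + k) (xs k) ⟨by omega, (hinv k).1, (hinv k).2⟩).1
  let ps : ℕ → Lˣ := fun k => ∏ j ∈ Finset.range k, ws j
  have hps_zero : ps 0 = 1 := Finset.prod_range_zero _
  have hps_succ : ∀ k, ps (k + 1) = ps k * ws k := fun k => Finset.prod_range_succ _ _
  have hpsV : ∀ k, ps k ∈ congrUnits b π hmul hπ r := fun k =>
    Subgroup.prod_mem _ fun j _ => congrUnits_antitone hmul hπ (by omega) (hwsV j)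
  -- `x = Φ (ps k) * xs k`
  have hrel : ∀ k, x = Φ (ps k) * xs k := by
    intro k
    induction k with
    | zero => rw [hps_zero, map_one, one_mul, hxs0]
    | succ k ih =>
      rw [hps_succ, map_mul, hxss, mul_assoc, mul_div_cancel]
      exact ih
  -- the Cauchy property and the limit
  have hcauchy : ∀ k, ((ps (k + 1) : Lˣ) : L) - (ps k : Lˣ) ∈ latt b π (r + k) := fun k => by
    rw [hps_succ]
    exact val_mul_sub_val_mem_latt hmul hπ (hpsV k) (hwsV k)
  obtain ⟨y, hy⟩ := exists_forall_sub_mem_latt (f := fun k => ((ps k : Lˣ) : L)) hπ hcauchy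
  have hyV : y ∈ CyclicNormIndex.congr b π r := by
    have := hy 0
    rw [hps_zero, add_zero, Units.val_one] at this
    exact this
  set yu : Lˣ := (isUnit_of_mem_congr hmul hπ hyV).unit with hyudef
  have hyuval : (yu : L) = y := IsUnit.unit_spec _
  have hyuV : yu ∈ congrUnits b π hmul hπ r := unit_mem_congrUnits hmul hπ hyV
  refine ⟨yu, hyuV, ?_⟩
  -- `x / Φ yu ∈ V_{r+k}` for every `k`
  have key : ∀ k, x / Φ yu ∈ congrUnits b π hmul hπ (r + k) := by
    intro k
    have hq : yu / ps k ∈ congrUnits b π hmul hπ (r + k) :=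
      div_mem_congrUnits_of_sub_mem hmul hπ (hpsV k) (by rw [hyuval]; exact hy k)
    have hΦq : Φ (yu / ps k) ∈ congrUnits b π hmul hπ (r + k) := hΦV _ _ hq
    have hΦy : Φ yu = Φ (yu / ps k) * Φ (ps k) := by rw [← map_mul, div_mul_cancel]
    have : x / Φ yu = xs k * (Φ (yu / ps k))⁻¹ := by
      rw [hΦy, hrel k, mul_comm (Φ (ps k)) (xs k), mul_div_mul_right_eq_div, div_eq_mul_inv]
    rw [this]
    exact Subgroup.mul_mem _ (hinv k).1 (Subgroup.inv_mem _ hΦq)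
  have h1 : ((x / Φ yu : Lˣ) : L) - 1 = 0 :=
    eq_zero_of_forall_mem_latt hπ fun k => latt_antitone hπ.le (by omega : k ≤ r + k) (key k)
  rw [sub_eq_zero, Units.val_eq_one, div_eq_one] at h1
  exact h1.symm

/-- **Every `G`-fixed element of `V_r` is a norm from `V_r`** (`H⁰(G, V_r) = 1`).
[cite: NeukirchANT1999, Ch. V §1 Thm. (1.1) (proof)] -/
theorem exists_norm_eq_of_fixed (hb : ∀ g h : G, g • b h = b (g * h))
    (hmul : ∀ i j k, ‖b.repr (b i * b j) k‖ ≤ ‖π‖) (hπ : ‖π‖ < 1) {r : ℕ} {x : Lˣ}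
    (hx : x ∈ congrUnits b π hmul hπ r) (hfix : ∀ g : G, g • x = x) :
    ∃ y ∈ congrUnits b π hmul hπ r, Herbrand.norm G y = x := by
  have hstep : ∀ s, r ≤ s → ∀ z ∈ congrUnits b π hmul hπ s, (∀ g : G, g • z = z) →
      ∃ w ∈ congrUnits b π hmul hπ s, z / Herbrand.norm G w ∈ congrUnits b π hmul hπ (s + 1) ∧
        ∀ g : G, g • (z / Herbrand.norm G w) = z / Herbrand.norm G w := by
    intro s _ z hz hzfix
    obtain ⟨w, hw, h⟩ := exists_div_norm_mem_congrUnits hb hmul hπ hz hzfix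
    exact ⟨w, hw, h, fun g => by rw [smul_div', hzfix g, Herbrand.smul_norm]⟩
  exact exists_apply_eq_of_step_units hmul hπ (Herbrand.norm G)
    (fun s w hw => norm_mem_congrUnits hb hmul hπ hw) (fun z => ∀ g : G, g • z = z) hstep hx hfix

/-- **Every norm-one element of `V_r` is `σ • y / y` with `y ∈ V_r`** (`H⁻¹(G, V_r) = 1`), for
`σ` a generator of `G`. [cite: NeukirchANT1999, Ch. V §1 Thm. (1.1) (proof)] -/
theorem exists_twist_eq_of_norm_eq_one (hb : ∀ g h : G, g • b h = b (g * h))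
    (hσ : ∀ τ : G, τ ∈ Subgroup.zpowers σ)
    (hmul : ∀ i j k, ‖b.repr (b i * b j) k‖ ≤ ‖π‖) (hπ : ‖π‖ < 1) {r : ℕ} {x : Lˣ}
    (hx : x ∈ congrUnits b π hmul hπ r) (hN : Herbrand.norm G x = 1) :
    ∃ y ∈ congrUnits b π hmul hπ r, Herbrand.twist σ y = x := by
  have hstep : ∀ s, r ≤ s → ∀ z ∈ congrUnits b π hmul hπ s, Herbrand.norm G z = 1 →
      ∃ w ∈ congrUnits b π hmul hπ s, z / Herbrand.twist σ w ∈ congrUnits b π hmul hπ (s + 1) ∧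
        Herbrand.norm G (z / Herbrand.twist σ w) = 1 := by
    intro s _ z hz hzN
    obtain ⟨w, hw, h⟩ := exists_div_twist_mem_congrUnits hb hσ hmul hπ hz hzN
    exact ⟨w, hw, h, by rw [map_div, hzN, Herbrand.norm_twist, div_one]⟩
  exact exists_apply_eq_of_step_units hmul hπ (Herbrand.twist σ)
    (fun s w hw => twist_mem_congrUnits hb hmul hπ σ hw) (fun z => Herbrand.norm G z = 1) hstep hx hN

/-- **`H⁰(G, V_r) = 1`** in the index language of `CyclicHerbrandQuotient.lean`
(`σ` a generator of `G`). [cite: NeukirchANT1999, Ch. V §1 Thm. (1.1) (proof)] -/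
theorem h0_congrUnits_eq_one (hb : ∀ g h : G, g • b h = b (g * h))
    (hσ : ∀ τ : G, τ ∈ Subgroup.zpowers σ)
    (hmul : ∀ i j k, ‖b.repr (b i * b j) k‖ ≤ ‖π‖) (hπ : ‖π‖ < 1) (r : ℕ) :
    Herbrand.h0 σ (congrUnits b π hmul hπ r) ⊥ = 1 := by
  rw [Herbrand.h0_eq_one_iff]
  intro x hx hT
  rw [Subgroup.mem_bot, div_eq_one] at hT
  obtain ⟨y, hy, hNy⟩ :=
    exists_norm_eq_of_fixed hb hmul hπ hx ((Herbrand.forall_smul_eq_iff hσ).mpr hT)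
  rw [Herbrand.b0_bot]
  exact ⟨y, hy, hNy⟩

/-- **`H⁻¹(G, V_r) = 1`** in the index language of `CyclicHerbrandQuotient.lean`
(`σ` a generator of `G`). [cite: NeukirchANT1999, Ch. V §1 Thm. (1.1) (proof)] -/
theorem h1_congrUnits_eq_one (hb : ∀ g h : G, g • b h = b (g * h))
    (hσ : ∀ τ : G, τ ∈ Subgroup.zpowers σ)
    (hmul : ∀ i j k, ‖b.repr (b i * b j) k‖ ≤ ‖π‖) (hπ : ‖π‖ < 1) (r : ℕ) :
    Herbrand.h1 σ (congrUnits b π hmul hπ r) ⊥ = 1 := by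
  rw [Herbrand.h1_eq_one_iff]
  intro x hx hN
  rw [Subgroup.mem_bot] at hN
  obtain ⟨y, hy, hTy⟩ := exists_twist_eq_of_norm_eq_one hb hσ hmul hπ hx hN
  rw [Herbrand.b1_bot]
  exact ⟨y, hy, hTy⟩

/-! ### The fixed elements of `V_r` and the norm group `N_G(V_r)` -/

omit [IsUltrametricDist K] [CompleteSpace K] in
/-- `1 + c · ∑_g b_g` is `G`-fixed. [folklore] -/
theorem smul_one_add_smul_sum (hb : ∀ g h : G, g • b h = b (g * h)) (g : G) (c : K) :
    g • (1 + c • ∑ h : G, b h) = 1 + c • ∑ h : G, b h := by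
  rw [smul_add, smul_one, smul_comm g, smul_sum_basis hb]

omit [CompleteSpace K] in
/-- **The `G`-fixed elements of `V_r` are the `1 + c · t`**, `t = ∑_g b_g`, `‖c‖ ≤ ‖π‖^r` (a fixed
element of the induced lattice has all its coordinates equal).
[cite: NeukirchANT1999, Ch. IV §7 Prop. (7.4)] -/
theorem exists_eq_one_add_smul_sum_of_fixed (hb : ∀ g h : G, g • b h = b (g * h))
    (hπ : ‖π‖ < 1) {r : ℕ} {x : L} (hx : x ∈ CyclicNormIndex.congr b π r) (hfix : ∀ g : G, g • x = x) :
    ∃ c : K, ‖c‖ ≤ ‖π‖ ^ r ∧ x = 1 + c • ∑ g : G, b g := by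
  set m := x - 1 with hm
  have hmM : m ∈ latt b π r := hx
  have hfixm : ∀ g : G, g • m = m := fun g => by rw [hm, smul_sub, smul_one, hfix g]
  refine ⟨b.repr m 1, hmM 1, ?_⟩
  have hall : ∀ g : G, b.repr m g = b.repr m 1 := fun g => by
    rw [← sub_eq_zero, ← norm_le_zero_iff]
    refine ge_of_tendsto (tendsto_pow_atTop_nhds_zero_of_lt_one (norm_nonneg π) hπ) ?_
    refine Filter.Eventually.of_forall fun s => norm_repr_sub_repr_one_le hb (fun h => ?_) g
    rw [hfixm h, sub_self]; exact zero_mem _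
  have : m = b.repr m 1 • ∑ g : G, b g := by
    conv_lhs => rw [← b.sum_repr m]
    rw [Finset.smul_sum]
    exact Finset.sum_congr rfl fun g _ => by rw [hall g]
  rw [← this, hm]; ring

/-- **The norm group `N_G(V_r)` contains every `1 + c · ∑_g b_g`, `‖c‖ ≤ ‖π‖^r`** (these are fixed,
hence norms by `H⁰(G, V_r) = 1`). [cite: NeukirchANT1999, Ch. V §1 Thm. (1.1) (proof)] -/
theorem exists_norm_eq_one_add_smul_sum (hb : ∀ g h : G, g • b h = b (g * h))
    (hmul : ∀ i j k, ‖b.repr (b i * b j) k‖ ≤ ‖π‖) (hπ : ‖π‖ < 1) {r : ℕ} {c : K}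
    (hc : ‖c‖ ≤ ‖π‖ ^ r) :
    ∃ y ∈ congrUnits b π hmul hπ r, ((Herbrand.norm G y : Lˣ) : L) = 1 + c • ∑ g : G, b g := by
  have hx := one_add_smul_sum_mem_congr (ι := G) (b := b) (π := π) hc
  set x : Lˣ := (isUnit_of_mem_congr hmul hπ hx).unit with hxdef
  have hxval : (x : L) = 1 + c • ∑ g : G, b g := IsUnit.unit_spec _
  have hxV : x ∈ congrUnits b π hmul hπ r := unit_mem_congrUnits hmul hπ hx
  have hfix : ∀ g : G, g • x = x := fun g => Units.ext (by
    rw [val_smul_units, hxval, smul_one_add_smul_sum hb])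
  obtain ⟨y, hy, hNy⟩ := exists_norm_eq_of_fixed hb hmul hπ hxV hfix
  exact ⟨y, hy, by rw [hNy, hxval]⟩

end Graded

end NormalBasisCongr

end Literature.NumberTheory.GaloisRepresentations
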